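import Mathlib.Data.Finset.Union
import Mathlib.Data.Finset.SDiff
import Mathlib.Data.Fintype.Basic
import HarnessLib

/-!
# `UV3BranchExpansionCountingAmortizedDiscovery` — (M′) «A READ DISTORTED TOWER IS EXPLORED»: the discovery half of the amortized covering
# inequality for the branch (Möbius) expansion of the guarded averaging (crux `UnitScaleTilt.HistoryTailL`, stmt-QuantumFields-19936 —
# SUPPLY side, record-independent finite combinatorics)

Cell `ym3-torus` (YM ladder rung R3 = continuum SU(2) Yang–Mills on T³ — a RUNG, NOT d = 4, NOT infinite volume, NOT a mass gap, NOT Clay);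
width seat `ym-ust-19936-w2` (gen 17), explicit-unit helper; `--supports stmt-QuantumFields-19936 --as helper`.  THEOREMS ONLY (0 `def`,
0 `sorry`, default heartbeats, Mathlib + HarnessLib imports only).

WHAT.  In the setting of `UV3BranchExpansionCountingAmortizedInduction` (bond types `β : ℕ → Type`, blocking data `R i, line i`, patterns
`p : (i : Fin n) → Finset (β (i+1))`, hypothesis-specified distorted sets `Dist p i` and explored sets `X m A p i` with
`hXm : X m A p m = A`, `hXS : X m A p i = (line(X m A p (i+1) ∖ p i) ∪ R(p i)) ∩ Dist p i` for `i < m`), the covering inequality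
✓-to-be `UV3BranchExpansionCountingAmortized.sum_pow_card_le_of_discoverable` counts the patterns DISCOVERABLE FROM THEIR OWN TOP DISTORTED SET.
LEAD ★w1-19936 g12's lemma (M) (`Cruxes/HistoryTailL/HTopBranchExpansion.md` §4) cancels every pattern with a MUTE switch site — one whose
distorted tower is read by no fired bond and does not reach the top level.  The bridge (M′) «no mute site ⇒ discoverable» therefore needs
exactly: A DISTORTED TOWER THAT REACHES THE TOP LEVEL OR IS READ BY A FIRED BOND IS EXPLORED ALL THE WAY DOWN.  This file proves that statement
abstractly, for a tower given as a function `t : (j : ℕ) → β j` on an index range `[a, l]`: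

★★ `mem_explored_of_tower`: if `t j ∈ line j (t (j+1))` for `a ≤ j < l` (tower), `t j ∈ Dist p j` for `a ≤ j ≤ l` (distorted), every guard
reads its own segment (`hRline : line i g ⊆ R i g`), and the tower is ANCHORED — `l = n`, or `l < n` and `t l ∈ R l c'` for some fired
`c' ∈ p l` — then `t j ∈ X n (Dist p n) p j` for every `a ≤ j ≤ l`; in particular (★ `mem_explored_union_of_tower`) a switch site `(a−1, t a)`
with `t a ∈ p (a−1)` satisfies the discoverability clause `t a ∈ X n (Dist p n) p a ∪ N`.  The descent uses only the shape of `hXS`: below an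
explored ghost its distorted line bonds are explored; below an explored FIRED bond its distorted read bonds — hence its own segment — are
explored; and the read set of EVERY fired bond of a step is explored whether or not that bond was itself explored (this is why no induction over
the reading sites is needed).

HONEST SCOPE.  [folklore] finite bookkeeping; the model's towers (`centralBond`, lit `AveragingRT.line`), the definition of «mute» on
`avT3`'s histories and lemma (M) itself are NOT here.  Nothing of hTop, the χ record, (O‴χₛ), `HistoryTailL`, R3 is proved; the Yang–Mills
mass gap is NOT proved.

References: T. Bałaban, CMP **102** (1985) 255–275 [Balaban1985UV3]; LEAD note `Cruxes/HistoryTailL/HTopBranchExpansion.md` §4–§5 (M), (M′)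
(2026-08-30); dag-n08-d `N08-HJ-M3-SPEC-g47.md` §1 (c) (a guard reads its own segment).
-/

set_option autoImplicit false

namespace Summit.QuantumFields.YangMills.Theorems.UV3BranchExpansionCountingAmortizedDiscovery

variable {β : ℕ → Type*} [∀ i, DecidableEq (β i)] {n : ℕ}
variable (R line : (i : ℕ) → β (i + 1) → Finset (β i))
variable (Dist : ((i : Fin n) → Finset (β ((i : ℕ) + 1))) → (i : ℕ) → Finset (β i))
variable (X : (m : ℕ) → Finset (β m) → ((i : Fin n) → Finset (β ((i : ℕ) + 1))) → (i : ℕ) → Finset (β i))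

/-- ★★ **A READ (OR TOP-REACHING) DISTORTED TOWER IS EXPLORED ALL THE WAY DOWN** (v1.1: `hRline` asked on the levels `i < n` only — the
dischargeable shape on a finite tower, w5-19936 g19 2026-08-30). [folklore] -/
theorem mem_explored_of_tower_of_lt
    (hRline : ∀ i, i < n → ∀ g : β (i + 1), line i g ⊆ R i g)
    (hXm : ∀ m (A : Finset (β m)) p, X m A p m = A)
    (hXS : ∀ m (A : Finset (β m)) p (i : Fin n), (i : ℕ) < m →
      X m A p i = ((X m A p ((i : ℕ) + 1) \ p i).biUnion (line i) ∪ (p i).biUnion (R i)) ∩ Dist p i)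
    (p : (i : Fin n) → Finset (β ((i : ℕ) + 1))) (t : (j : ℕ) → β j) {a l : ℕ} (hal : a ≤ l) (hln : l ≤ n)
    (htower : ∀ j, a ≤ j → j < l → t j ∈ line j (t (j + 1)))
    (hdist : ∀ j, a ≤ j → j ≤ l → t j ∈ Dist p j)
    (hanchor : l = n ∨ ∃ h : l < n, ∃ c' ∈ p ⟨l, h⟩, t l ∈ R l c') :
    ∀ j, a ≤ j → j ≤ l → t j ∈ X n (Dist p n) p j := by
  -- the anchor level is explored
  have htop : t l ∈ X n (Dist p n) p l := by
    rcases hanchor with h | ⟨h, c', hc', hread⟩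
    · subst h; rw [hXm]; exact hdist l hal le_rfl
    · have hX := hXS n (Dist p n) p ⟨l, h⟩ h
      simp only [Fin.val_mk] at hX
      rw [hX]
      exact Finset.mem_inter.mpr
        ⟨Finset.mem_union_right _ (Finset.mem_biUnion.mpr ⟨c', hc', hread⟩), hdist l hal le_rfl⟩
  -- descend the tower
  suffices hdesc : ∀ d j, j + d = l → a ≤ j → t j ∈ X n (Dist p n) p j by
    intro j haj hjl; exact hdesc (l - j) j (by omega) haj
  intro d
  induction d with
  | zero => intro j hj _; rw [Nat.add_zero] at hj; subst hj; exact htop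
  | succ d ih =>
    intro j hj haj
    have hjl : j < l := by omega
    have hjn : j < n := lt_of_lt_of_le hjl hln
    have hup : t (j + 1) ∈ X n (Dist p n) p (j + 1) := ih (j + 1) (by omega) (by omega)
    have hX := hXS n (Dist p n) p ⟨j, hjn⟩ hjn
    simp only [Fin.val_mk] at hX
    rw [hX]
    refine Finset.mem_inter.mpr ⟨?_, hdist j haj hjl.le⟩
    by_cases hfired : t (j + 1) ∈ p ⟨j, hjn⟩
    · -- below an explored FIRED bond, its own segment lies in its explored read set
      exact Finset.mem_union_right _
        (Finset.mem_biUnion.mpr ⟨t (j + 1), hfired, hRline j hjn (t (j + 1)) (htower j haj hjl)⟩)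
    · -- below an explored GHOST, its distorted line bonds are explored
      exact Finset.mem_union_left _
        (Finset.mem_biUnion.mpr ⟨t (j + 1), Finset.mem_sdiff.mpr ⟨hup, hfired⟩, htower j haj hjl⟩)

/-- v1.0 statement of `mem_explored_of_tower_of_lt` (`hRline` for every `i : ℕ`), kept as its corollary. [folklore] -/
theorem mem_explored_of_tower
    (hRline : ∀ i (g : β (i + 1)), line i g ⊆ R i g)
    (hXm : ∀ m (A : Finset (β m)) p, X m A p m = A)
    (hXS : ∀ m (A : Finset (β m)) p (i : Fin n), (i : ℕ) < m →
      X m A p i = ((X m A p ((i : ℕ) + 1) \ p i).biUnion (line i) ∪ (p i).biUnion (R i)) ∩ Dist p i)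
    (p : (i : Fin n) → Finset (β ((i : ℕ) + 1))) (t : (j : ℕ) → β j) {a l : ℕ} (hal : a ≤ l) (hln : l ≤ n)
    (htower : ∀ j, a ≤ j → j < l → t j ∈ line j (t (j + 1)))
    (hdist : ∀ j, a ≤ j → j ≤ l → t j ∈ Dist p j)
    (hanchor : l = n ∨ ∃ h : l < n, ∃ c' ∈ p ⟨l, h⟩, t l ∈ R l c') :
    ∀ j, a ≤ j → j ≤ l → t j ∈ X n (Dist p n) p j :=
  mem_explored_of_tower_of_lt R line Dist X (fun i _ => hRline i) hXm hXS p t hal hln htower hdist hanchor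

/-- ★ **THE DISCOVERABILITY CLAUSE FOR A NON-MUTE SWITCH SITE** (v1.1, `hRline` on `i < n`).  A fired bond `t a ∈ p (a−1)` whose distorted tower is anchored (read by a fired
bond, or reaching the top) is explored from the top distorted set, hence satisfies the clause `p (a−1) ∋ t a ∈ X n (Dist p n) p a ∪ N` of
✓-to-be `UV3BranchExpansionCountingAmortized.sum_pow_card_le_of_discoverable` (with any `N`). [folklore] -/
theorem mem_explored_union_of_tower_of_lt
    (hRline : ∀ i, i < n → ∀ g : β (i + 1), line i g ⊆ R i g)
    (hXm : ∀ m (A : Finset (β m)) p, X m A p m = A)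
    (hXS : ∀ m (A : Finset (β m)) p (i : Fin n), (i : ℕ) < m →
      X m A p i = ((X m A p ((i : ℕ) + 1) \ p i).biUnion (line i) ∪ (p i).biUnion (R i)) ∩ Dist p i)
    (p : (i : Fin n) → Finset (β ((i : ℕ) + 1))) (t : (j : ℕ) → β j) {a l : ℕ} (hal : a ≤ l) (hln : l ≤ n)
    (htower : ∀ j, a ≤ j → j < l → t j ∈ line j (t (j + 1)))
    (hdist : ∀ j, a ≤ j → j ≤ l → t j ∈ Dist p j)
    (hanchor : l = n ∨ ∃ h : l < n, ∃ c' ∈ p ⟨l, h⟩, t l ∈ R l c')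
    (Nset : Finset (β a)) :
    t a ∈ X n (Dist p n) p a ∪ Nset :=
  Finset.mem_union_left _
    (mem_explored_of_tower_of_lt R line Dist X hRline hXm hXS p t hal hln htower hdist hanchor a le_rfl hal)


/-- v1.0 statement of `mem_explored_union_of_tower_of_lt`, kept as its corollary. [folklore] -/
theorem mem_explored_union_of_tower
    (hRline : ∀ i (g : β (i + 1)), line i g ⊆ R i g)
    (hXm : ∀ m (A : Finset (β m)) p, X m A p m = A)
    (hXS : ∀ m (A : Finset (β m)) p (i : Fin n), (i : ℕ) < m →
      X m A p i = ((X m A p ((i : ℕ) + 1) \ p i).biUnion (line i) ∪ (p i).biUnion (R i)) ∩ Dist p i)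
    (p : (i : Fin n) → Finset (β ((i : ℕ) + 1))) (t : (j : ℕ) → β j) {a l : ℕ} (hal : a ≤ l) (hln : l ≤ n)
    (htower : ∀ j, a ≤ j → j < l → t j ∈ line j (t (j + 1)))
    (hdist : ∀ j, a ≤ j → j ≤ l → t j ∈ Dist p j)
    (hanchor : l = n ∨ ∃ h : l < n, ∃ c' ∈ p ⟨l, h⟩, t l ∈ R l c')
    (Nset : Finset (β a)) :
    t a ∈ X n (Dist p n) p a ∪ Nset :=
  mem_explored_union_of_tower_of_lt R line Dist X (fun i _ => hRline i) hXm hXS p t hal hln htower hdist hanchor Nset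

end Summit.QuantumFields.YangMills.Theorems.UV3BranchExpansionCountingAmortizedDiscovery
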